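import Summits.AtomisticToContinuum.BoseEinsteinCondensation.Theorems.BECConjugateDominationHardCoreExtensionBoundedPositiveMinimiserHolds
import Literature.MathematicalPhysics.QuantumManyBody.PeriodicFeynmanKacCell
import HarnessLib

/-!
# The Feynman–Kac positive minimiser of a bounded admissible potential, with its uniform sup bound
# (stub `stub_fkPositiveMinimiserSupBound`, I1 of the (α'_int) programme; line `third-law-current-floor`,
# crux `BECConjugateDomination.HardCoreExtension`, stmt-AtomisticToContinuum-11786)

For every BOUNDED repulsive finite-range pair potential `v` (`v ≤ M < ⊤`), every `n` and every torus side
`L > 0`, the periodic `(n+1)`-body energy has a strictly positive real `C¹` minimiser `Ψ` in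
`PeriodicTrialState (n+1) L`, of finite energy (as in `stub_boundedPositiveMinimiserHolds`), which MOREOVER
obeys the pointwise bound

  `‖Ψ(X)‖ ≤ e^{E₀} · pHeatConst (n+1) L 1 · |cell|^{1/2}`,  `E₀ = periodicGroundStateEnergy v (n+1) L`.

Proof. The minimiser of `…BoundedPositiveMinimiser.lean` IS the Feynman–Kac ground state `Ψ₀` of
`PeriodicGroundStateFeynmanKac_holds` (bounded periodisation `exists_periodizedPotential_le`, `C¹` by
`stub_periodicGroundStateRegularity`), read as the trial state `X ↦ (Ψ₀ X : ℂ)`; here the assembly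
`positiveMinimiser_of_isPeriodicGroundStateFK` is re-run keeping the witness `Ψ₀` explicit
(`FKSupBound.positiveMinimiser_eq_ofReal`). The sup bound is the eigen-relation `Ψ₀ = e^{E₀}e^{-H}Ψ₀`
(`IsPeriodicGroundStateFK.ofReal_exp_mul_periodicFKSemigroup` at `T = 1`) combined with the
`L²(cell) → L^∞` bound `periodicFKSemigroup_le_L2cell` of the periodic Feynman–Kac functional (valid for
every potential, weights `≤ 1`) and the normalisation `∫_cell Ψ₀² = 1`. [folklore; ChungZhao1995 Thm 3.10]
-/

noncomputable section

namespace Summit.AtomisticToContinuum.BoseEinsteinCondensation.Cruxes.HardCoreExtension.ThirdLawCurrentFloor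

open MeasureTheory Filter
open scoped ENNReal NNReal BigOperators Topology
open Literature.MathematicalPhysics.QuantumManyBody.BoseGas
open Literature.MathematicalPhysics.QuantumManyBody

namespace FKSupBound

variable {N : ℕ} {L : ℝ} {v : ℝ → ℝ≥0∞} {Ψ₀ : Config N → ℝ}

/-- **A `C¹`, strictly positive Feynman–Kac ground state, read as a periodic trial state, is a positive
minimiser** — the assembly `positiveMinimiser_of_isPeriodicGroundStateFK` of
`…BoundedPositiveMinimiser.lean` with the witness kept explicit: for `L > 0`, `v` measurable with
`v^per ≤ C`, and a `C¹` pointwise strictly positive witness `Ψ₀` of `IsPeriodicGroundStateFK v L Ψ₀`, there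
is a periodic trial state `Ψ` WITH `Ψ.ψ = (Ψ₀ : ℂ)` attaining `periodicGroundStateEnergy v N L`, of finite
energy, real nonnegative and nowhere zero. [folklore; ChungZhao1995 Thm 3.27 and Prop 3.29 (81)] -/
theorem positiveMinimiser_eq_ofReal (hL : 0 < L) (hv : Measurable v) {C : ℝ≥0}
    (hC : ∀ x, periodizedPotential v L x ≤ C) (hGS : IsPeriodicGroundStateFK v L Ψ₀)
    (hC1 : ContDiff ℝ 1 Ψ₀) (hpos : ∀ X, 0 < Ψ₀ X) :
    ∃ Ψ : PeriodicTrialState N L, (∀ X, Ψ.ψ X = ((Ψ₀ X : ℝ) : ℂ)) ∧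
      periodicEnergy v Ψ = periodicGroundStateEnergy v N L ∧ periodicEnergy v Ψ ≠ ⊤ ∧
      (∀ X, Ψ.ψ X = (‖Ψ.ψ X‖ : ℂ)) ∧ (∀ X, Ψ.ψ X ≠ 0) := by
  -- assembly adapted from …BoundedPositiveMinimiser.lean (witness kept explicit)
  have hcont : Continuous Ψ₀ := hC1.continuous
  have hper := hGS.periodic
  have hnn := hGS.nonneg
  have hΨm : Measurable Ψ₀ := hcont.measurable
  obtain ⟨M, -, hM⟩ := exists_bound_of_continuous_periodic hL hcont hper
  have hsq : Integrable (fun X => Ψ₀ X ^ 2) (volume.restrict (cellN N L)) :=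
    (memLp_two_cellN_of_bound L hΨm hM).integrable_sq
  have hnorm : ∫ X in cellN N L, Ψ₀ X ^ 2 = 1 :=
    integral_cellN_sq_eq_one_of_isPeriodicGroundStateFK hL hGS hcont
  -- the eigenvalue in real form
  set lam : ℝ := (periodicGroundStateEnergy v N L).toReal with hlam
  have hE₀ : periodicGroundStateEnergy v N L = ENNReal.ofReal lam :=
    (ENNReal.ofReal_toReal hGS.energy_ne_top).symm
  have heig : ∀ t : ℝ, 0 < t →
      Real.exp (-(lam * t)) ≤ ∫ X in cellN N L, Ψ₀ X * pfkReal v L t Ψ₀ X := fun t ht =>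
    (integral_cellN_mul_pfkReal_of_isPeriodicGroundStateFK hL hv hGS hcont ht.le).ge
  -- the potential part
  set Pot : ℝ := ∫ X in cellN N L, Ψ₀ X ^ 2 * (periodicInteraction v L X).toReal with hPot
  have hPot0 : 0 ≤ Pot := integral_nonneg fun X => mul_nonneg (sq_nonneg _) ENNReal.toReal_nonneg
  have hPotle : Pot ≤ lam :=
    setIntegral_cellN_sq_mul_periodicInteraction_le hv hL hC hcont hper hnn hnorm heig
  have hpotE : ∫⁻ X in cellN N L, ENNReal.ofReal (Ψ₀ X ^ 2) * periodicInteraction v L X =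
      ENNReal.ofReal Pot :=
    setLIntegral_cellN_sq_mul_periodicInteraction_eq_ofReal hv hC hΨm hsq
  -- the kinetic part: Fatou against the eigenfunction bound
  have hkin : ∫⁻ X in cellN N L, realKinetic Ψ₀ X ≤ ENNReal.ofReal (lam - Pot) := by
    refine ENNReal.le_of_forall_pos_le_add fun ε hε _ => ?_
    have hε' : (0 : ℝ) < ε := by exact_mod_cast hε
    have hK' : lam - Pot < lam - Pot + ε := by linarith
    have hev := sqIncrCell_div_eventually_le hv hL hC hcont hper hnn hnorm heig hK'
    calc ∫⁻ X in cellN N L, realKinetic Ψ₀ X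
        ≤ liminf (fun t : ℝ≥0 => (ENNReal.ofReal (2 * t))⁻¹ * sqIncrCell L t Ψ₀) (𝓝[>] 0) :=
          kinetic_le_liminf_sqIncrCell L hC1
      _ ≤ liminf (fun _ : ℝ≥0 => ENNReal.ofReal (lam - Pot + ε)) (𝓝[>] 0) := liminf_le_liminf hev
      _ = ENNReal.ofReal (lam - Pot + ε) := liminf_const _
      _ ≤ ENNReal.ofReal (lam - Pot) + ENNReal.ofReal ε := ENNReal.ofReal_add_le
      _ = ENNReal.ofReal (lam - Pot) + ε := by rw [ENNReal.ofReal_coe_nnreal]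
  -- the trial state `X ↦ Ψ₀ X`
  have hnormΨ : ∫⁻ X in cellN N L, ((‖((Ψ₀ X : ℝ) : ℂ)‖₊ : ℝ≥0∞)) ^ 2 = 1 := by
    have h1 : ∀ X, ((‖((Ψ₀ X : ℝ) : ℂ)‖₊ : ℝ≥0∞)) ^ 2 = ENNReal.ofReal (Ψ₀ X) ^ 2 := fun X => by
      rw [ennnorm_sq_ofReal_periodic, ENNReal.ofReal_pow (hnn X)]
    simp_rw [h1]
    exact hGS.norm_eq
  let Ψ : PeriodicTrialState N L :=
    { ψ := fun X => ((Ψ₀ X : ℝ) : ℂ)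
      contDiff := Complex.ofRealCLM.contDiff.comp hC1
      periodic := fun X i k => by
        show ((Ψ₀ (X + Pi.single i (EuclideanSpace.single k L)) : ℝ) : ℂ) = ((Ψ₀ X : ℝ) : ℂ)
        rw [hper]
      symm := fun σ X => by
        show ((Ψ₀ (X ∘ σ) : ℝ) : ℂ) = ((Ψ₀ X : ℝ) : ℂ)
        rw [hGS.symm]
      norm_eq := hnormΨ }
  have hΨeq : Ψ.ψ = fun X => (((1 * Ψ₀ X : ℝ)) : ℂ) := by
    funext X
    rw [one_mul]
  -- the energy identity
  have hE : periodicEnergy v Ψ = (∫⁻ X in cellN N L, realKinetic Ψ₀ X) +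
      ∫⁻ X in cellN N L, ENNReal.ofReal (Ψ₀ X ^ 2) * periodicInteraction v L X := by
    rw [periodicEnergy_of_ofReal_mul Ψ hC1 hΨeq v, one_pow, ENNReal.ofReal_one, one_mul]
  have hEle : periodicEnergy v Ψ ≤ periodicGroundStateEnergy v N L := by
    rw [hE, hpotE, hE₀]
    calc (∫⁻ X in cellN N L, realKinetic Ψ₀ X) + ENNReal.ofReal Pot
        ≤ ENNReal.ofReal (lam - Pot) + ENNReal.ofReal Pot := add_le_add hkin le_rfl
      _ = ENNReal.ofReal lam := by
          rw [← ENNReal.ofReal_add (sub_nonneg.2 hPotle) hPot0, sub_add_cancel]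
  have hEeq : periodicEnergy v Ψ = periodicGroundStateEnergy v N L :=
    le_antisymm hEle (periodicGroundStateEnergy_le v Ψ)
  refine ⟨Ψ, fun X => rfl, hEeq, ?_, fun X => ?_, fun X => ?_⟩
  · rw [hEeq]; exact hGS.energy_ne_top
  · show ((Ψ₀ X : ℝ) : ℂ) = ((‖((Ψ₀ X : ℝ) : ℂ)‖ : ℝ) : ℂ)
    rw [Complex.norm_real, Real.norm_of_nonneg (hnn X)]
  · show ((Ψ₀ X : ℝ) : ℂ) ≠ 0
    exact Complex.ofReal_ne_zero.2 (hpos X).ne'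

/-- **The uniform sup bound of a Feynman–Kac ground state on the torus**: for `L > 0` and a witness `Ψ₀`
of `IsPeriodicGroundStateFK v L Ψ₀`, pointwise
`Ψ₀(X) ≤ e^{E₀} · pHeatConst N L 1 · |cell|^{1/2}`, `E₀ = periodicGroundStateEnergy v N L`: the
eigen-relation `Ψ₀ = e^{E₀} e^{-H} Ψ₀` at time `1` and the `L²(cell) → L^∞` bound of the periodic
Feynman–Kac functional, `‖Ψ₀‖_{L²(cell)} = 1`. [folklore; ChungZhao1995 Thm 3.10] -/
theorem ofReal_le_of_isPeriodicGroundStateFK (hL : 0 < L) (hGS : IsPeriodicGroundStateFK v L Ψ₀)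
    (X : Config N) :
    ENNReal.ofReal (Ψ₀ X) ≤
      ENNReal.ofReal (Real.exp (periodicGroundStateEnergy v N L).toReal) *
        (pHeatConst N L 1 * volume (cellN N L) ^ (1 / 2 : ℝ)) := by
  have hg : Measurable fun Y => ENNReal.ofReal (Ψ₀ Y) := hGS.measurable.ennreal_ofReal
  have h1 := hGS.ofReal_exp_mul_periodicFKSemigroup zero_le_one X
  rw [mul_one] at h1
  rw [← h1]
  refine mul_le_mul' le_rfl ?_
  have h2 := periodicFKSemigroup_le_L2cell v hL one_pos hg hGS.ofReal_periodic X
  have h3 : ∫⁻ Y in cellN N L, ENNReal.ofReal (Ψ₀ Y) ^ (2 : ℝ) = 1 := by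
    rw [← hGS.norm_eq]
    exact lintegral_congr fun Y => ENNReal.rpow_two _
  rwa [h3, ENNReal.one_rpow, mul_one, Real.toNNReal_one] at h2

end FKSupBound

open FKSupBound

/-- **I1 `stub_fkPositiveMinimiserSupBound`** (the Feynman–Kac positive minimiser of a BOUNDED admissible
potential, with its uniform sup bound). For every bounded admissible `v`, every `n`, `L > 0`: a strictly
positive real `C¹` minimiser `Ψ` of the periodic `(n+1)`-body energy (as in
`stub_boundedPositiveMinimiserHolds`) which moreover satisfies the pointwise bound
`|Ψ(X)| ≤ e^{E₀(v,n+1,L)} · pHeatConst (n+1) L 1 · |cell|^{1/2}` (eigen-relation `Ψ₀ = e^{E₀}e^{-H}Ψ₀` of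
the FK witness, `IsPeriodicGroundStateFK.eigen` at `T = 1`, and the `L²(cell) → L^∞` bound
`periodicFKSemigroup_le_L2cell` of the FK functional, valid for every potential). Proof: the assembly of
`stub_boundedPositiveMinimiser` (`exists_periodizedPotential_le`, `PeriodicGroundStateFeynmanKac_holds`,
`stub_periodicGroundStateRegularity`, `FKSupBound.positiveMinimiser_eq_ofReal`) keeping the witness `Ψ₀` in
hand, and `FKSupBound.ofReal_le_of_isPeriodicGroundStateFK`. [folklore; ChungZhao1995 Thm 3.10] -/
theorem stub_fkPositiveMinimiserSupBound :
    ∀ v : ℝ → ℝ≥0∞, IsRepulsiveFiniteRange v → (∃ M : ℝ≥0∞, M ≠ ⊤ ∧ ∀ r, v r ≤ M) →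
      ∀ (n : ℕ) (L : ℝ), 0 < L → ∃ Ψ : PeriodicTrialState (n + 1) L,
        periodicEnergy v Ψ = periodicGroundStateEnergy v (n + 1) L ∧ periodicEnergy v Ψ ≠ ⊤ ∧
        (∀ X, Ψ.ψ X = (‖Ψ.ψ X‖ : ℂ)) ∧ (∀ X, Ψ.ψ X ≠ 0) ∧
        (∀ X, ((‖Ψ.ψ X‖₊ : ℝ≥0∞)) ≤
          ENNReal.ofReal (Real.exp (periodicGroundStateEnergy v (n + 1) L).toReal) *
            (pHeatConst (n + 1) L 1 * volume (cellN (n + 1) L) ^ (1 / 2 : ℝ))) := by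
  intro v hv hM n L hL
  obtain ⟨C, hC⟩ := exists_periodizedPotential_le hv hM hL
  have hN : 1 ≤ n + 1 := Nat.le_add_left 1 n
  obtain ⟨Ψ₀, hGS, -, hpos⟩ := PeriodicGroundStateFeynmanKac_holds (n + 1) L v hN hL hv.1 ⟨C, hC⟩
  have hC1 : ContDiff ℝ 1 Ψ₀ :=
    stub_periodicGroundStateRegularity (n + 1) L v hN hL hv.1 ⟨C, hC⟩ Ψ₀ hGS
  obtain ⟨Ψ, hΨ, hE, hfin, hreal, hne⟩ := positiveMinimiser_eq_ofReal hL hv.1 hC hGS hC1 hpos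
  refine ⟨Ψ, hE, hfin, hreal, hne, fun X => ?_⟩
  -- `‖(Ψ₀ X : ℂ)‖₊ = ofReal (Ψ₀ X)` in `[0, ∞]` (`Ψ₀ ≥ 0`), then the sup bound of the witness
  rw [hΨ X, nnnorm_real_complex, Real.nnnorm_of_nonneg (hGS.nonneg X),
    ← ENNReal.ofReal_eq_coe_nnreal (hGS.nonneg X)]
  exact ofReal_le_of_isPeriodicGroundStateFK hL hGS X

end Summit.AtomisticToContinuum.BoseEinsteinCondensation.Cruxes.HardCoreExtension.ThirdLawCurrentFloor

end
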